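import Summits.AtomisticToContinuum.HydrodynamicLimit.Theorems.InformationPercolationEnginePercolationClosesChaosForecastEnumeration
import Literature.Analysis.FluidPDE.HardSphereWindowEnumeration
import HarnessLib

/-!
# Forecast transfer S6 of the line `equilibrium-forecast-chain-rule` (crux `InformationPercolationEngine.PercolationClosesChaos`,
stmt-AtomisticToContinuum-15178) — piece H4/D: the REVEALED DICTIONARY of the owned collision count

Support file (`--supports stmt-AtomisticToContinuum-15178`) of the helper `revealedSandwich_of :
RevealedDefectStability → RevealedSandwich` (hypothesis H4 of the architecture `kineticCellChaosLG_of`, worker W3 of lead c3).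
It proves the one combinatorial fact H4 needs about the line's filtration: ON THE GOOD SET OF THE FLOW, THE OWNED COLLISION
COUNT `ownedCount c σ N Φ k q` OF THE UNIT `(k, q)` IS A FUNCTION OF THE DATA `seqHistLE b c σ N Φ k q` REVEALED RIGHT AFTER
THAT UNIT (registered headline `ownedCount_eq_of_seqHistLE_eq`).

The dictionary, step by step (all on `Φ.good`, `0 < c`, `0 < σ < 1/2` so that the torus geometry is regular and both orders of
every contact pair are contact pairs):

* `ite_cellMin_eq` / `sum_ite_cellMin_eq`: an ordered contact pair `(i, j)` of the step is owned by `q` (lex-min of the two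
  start cells is `q`) iff `i` starts in `q` and `j` not below `q`, or `j` starts in `q` and `i` strictly above `q`; swapping the
  second kind (`sum_collTriples_swap`) the owned count is the sum over the triples `(s, i, j)` WHOSE FIRST MEMBER STARTS IN `q`
  of the weight `𝟙{¬ sc j <ₗₑₓ q} + 𝟙{q <ₗₑₓ sc j}` of the partner's start cell;
* `sum_filter_fst_eq_sum_range`: for a fixed first member `i`, the triples `(s, i, j)` of the step window `(kΔ, (k+1)Δ]` are
  enumerated, injectively, by the indices `n < #(collision times of i in (0, (k+1)Δ])` with `kΔ < t_n` through
  `n ↦ (Φ.nthCollisionTimeOf i n z, i, Φ.nthPartnerOf i n z)` (window enumeration `nthCollisionTimeOf_mem_window`,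
  `strictMonoOn_nthCollisionTimeOf_window`, `exists_lt_ncard_nthCollisionTimeOf_eq` of the Literature; binary collisions:
  `nthPartnerOf_eq`; regularity: `swap_mem_contactPairs_iff`) — exactly the index list behind `jumps b c σ N Φ (k+1) i z`;
* `ownedCount_eq_sum_obs`: hence `(n̄c) · ownedCount k q z = Σ_{i : (obs k z i).1.1 = q} Σ_{records r ∈ (obs (k+1) z i).2}
  weight((obs k z r.1).1.1)` — the start cells are read off `obs k` (first component of the history), the records of the spheres
  starting in `q` off `obs (k+1)`, which `seqHistLE k q` reveals for every sphere not starting strictly above `q`;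
* `ownedCount_eq_of_seqHistLE_eq`: two good phase points with the same revealed data have the same owned count.

Bookkeeping only (Gallagher–Saint-Raymond–Texier 2013 Prop. 4.1.1: finitely many, enumerated collisions on the good set).
-/

noncomputable section

open MeasureTheory Set Filter Topology
open scoped ENNReal BigOperators Classical
open Literature.Analysis.FluidPDE Literature.MathematicalPhysics.KineticTheory
open Literature.MathematicalPhysics.KineticTheory.VelocityBlindPlacement

namespace Summit.AtomisticToContinuum.HydrodynamicLimit.Theorems.EquilibriumForecastLine

/-! ## The owner indicator seen from the first member -/

/-- **Ownership, pointwise.** The pair with start cells `(a, b)` is owned by `q` iff `a = q` and `b` is not below `q`, or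
`b = q` and `a` is strictly above `q` (the two cases are exclusive). [folklore] -/
theorem ite_cellMin_eq (a b q : Cell) :
    (if cellMin a b = q then (1 : ℝ) else 0) =
      (if a = q ∧ ¬ cellLT b q then (1 : ℝ) else 0) + (if b = q ∧ cellLT q a then (1 : ℝ) else 0) := by
  unfold cellMin
  by_cases h : cellLT b a
  · rw [if_pos h]
    by_cases hb : b = q
    · subst hb
      have ha : ¬ (a = b ∧ ¬ cellLT b b) := fun hab => by rw [hab.1] at h; exact cellLT_irrefl b h
      rw [if_pos rfl, if_neg ha, if_pos ⟨rfl, h⟩, zero_add]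
    · have ha : ¬ (a = q ∧ ¬ cellLT b q) := fun haq => by rw [haq.1] at h; exact haq.2 h
      rw [if_neg hb, if_neg ha, if_neg (fun hbq => hb hbq.1), add_zero]
  · rw [if_neg h]
    by_cases ha : a = q
    · subst ha
      have hb : ¬ (b = a ∧ cellLT a a) := fun hba => cellLT_irrefl a hba.2
      rw [if_pos rfl, if_pos ⟨rfl, h⟩, if_neg hb, add_zero]
    · have hb : ¬ (b = q ∧ cellLT q a) := fun hbq => by rw [hbq.1] at h; exact h hbq.2
      rw [if_neg ha, if_neg (fun haq => ha haq.1), if_neg hb, add_zero]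

/-- A `List.range` filter-map sum is the corresponding `Finset` sum. [folklore] -/
theorem sum_map_filter_range {M : Type*} [AddCommMonoid M] (J : ℕ) (p : ℕ → Prop) [DecidablePred p] (f : ℕ → M) :
    (((List.range J).filter fun n => decide (p n)).map f).sum = ∑ n ∈ (Finset.range J).filter p, f n := by
  induction J with
  | zero => simp
  | succ J ih =>
    rw [List.range_succ, List.filter_append, List.map_append, List.sum_append, ih, Finset.range_add_one,
      Finset.filter_insert]
    by_cases hJ : p J
    · have hnot : J ∉ (Finset.range J).filter p := fun h => by simp at h
      rw [if_pos hJ, Finset.sum_insert hnot, add_comm]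
      simp [hJ]
    · rw [if_neg hJ]
      simp [hJ]

section Dictionary

variable {σ : ℝ} {N : ℕ} (Φ : Flow σ N) {z : Phase N}

/-- **Ownership through the first member.** On the good set (`0 < σ < 1/2`) the number of ordered contact triples of the
step owned by `q` equals the sum, over the triples whose FIRST member starts in `q`, of the weight
`𝟙{¬ sc j <ₗₑₓ q} + 𝟙{q <ₗₑₓ sc j}` of the second member's start cell (the pairs owned through their second member are
re-indexed by swapping, `sum_collTriples_swap`). [folklore] -/
theorem sum_ite_cellMin_eq (hz : z ∈ Φ.good) (hσ : 0 < σ) (hσ2 : σ < 2⁻¹) (c : ℝ) (k : ℕ) (q : Cell) :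
    ∑ e ∈ collTriples Φ (stepWindow c σ N k) z,
        (if cellMin (startCell c σ N Φ k z e.2.1) (startCell c σ N Φ k z e.2.2) = q then (1 : ℝ) else 0) =
      ∑ e ∈ collTriples Φ (stepWindow c σ N k) z,
        (if startCell c σ N Φ k z e.2.1 = q then
          ((if cellLT (startCell c σ N Φ k z e.2.2) q then (0 : ℝ) else 1) +
            (if cellLT q (startCell c σ N Φ k z e.2.2) then (1 : ℝ) else 0)) else 0) := by
  have hε : hsDiameter σ N < 2⁻¹ := (hsDiameter_le hσ.le N).trans_lt hσ2
  have hW := stepWindow_subset_Icc c σ N k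
  simp_rw [ite_cellMin_eq]
  rw [Finset.sum_add_distrib]
  -- the pairs owned through their second member, swapped
  have hswap : ∑ e ∈ collTriples Φ (stepWindow c σ N k) z,
      (if startCell c σ N Φ k z e.2.2 = q ∧ cellLT q (startCell c σ N Φ k z e.2.1) then (1 : ℝ) else 0) =
      ∑ e ∈ collTriples Φ (stepWindow c σ N k) z,
      (if startCell c σ N Φ k z e.2.1 = q ∧ cellLT q (startCell c σ N Φ k z e.2.2) then (1 : ℝ) else 0) := by
    rw [← sum_collTriples_swap Φ hz hW hε (fun e =>
      if startCell c σ N Φ k z e.2.1 = q ∧ cellLT q (startCell c σ N Φ k z e.2.2) then (1 : ℝ) else 0)]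
    rfl
  rw [hswap, ← Finset.sum_add_distrib]
  refine Finset.sum_congr rfl fun e _ => ?_
  by_cases h1 : startCell c σ N Φ k z e.2.1 = q
  · by_cases h2 : cellLT (startCell c σ N Φ k z e.2.2) q
    · simp only [h1, h2, not_true_eq_false, and_false, if_false, true_and, if_true, zero_add]
    · simp only [h1, h2, not_false_eq_true, and_self, if_true, true_and, if_false]
  · simp only [h1, false_and, if_false, add_zero]

/-- **The triples with a given first member are that member's enumerated collisions of the step.** On the good set
(`0 < c`, `0 < σ < 1/2`), for every sphere `i` and every summand `g (time) (second member)`: the sum over the collision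
triples `(s, i, j)` of the step window `(kΔ, (k+1)Δ]` equals the sum over the indices `n` below the window count
`#(collision times of i in (0, (k+1)Δ])` with `kΔ < t_n` of `g t_n (Φ.nthPartnerOf i n z)`, `t_n = Φ.nthCollisionTimeOf i n z`
— the index list of `jumps b c σ N Φ (k+1) i z`. [folklore] -/
theorem sum_filter_fst_eq_sum_range (hz : z ∈ Φ.good) {c : ℝ} (hc : 0 < c) (hσ : 0 < σ) (hσ2 : σ < 2⁻¹) (k : ℕ)
    (i : Fin (N + 1)) (g : ℝ → Fin (N + 1) → ℝ) :
    ∑ e ∈ (collTriples Φ (stepWindow c σ N k) z).filter (fun e => e.2.1 = i), g e.1 e.2.2 =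
      ∑ n ∈ (Finset.range (Set.ncard (collisionTimesOf G3 (hsDiameter σ N) (fun t => Φ.flow t z) i ∩
          Set.Ioc 0 (((k : ℝ) + 1) * stepLen c σ N)))).filter
            (fun n => (k : ℝ) * stepLen c σ N < Φ.nthCollisionTimeOf i n z),
        g (Φ.nthCollisionTimeOf i n z) (Φ.nthPartnerOf i n z) := by
  have hε : hsDiameter σ N < 2⁻¹ := (hsDiameter_le hσ.le N).trans_lt hσ2
  have hG := Torus.isHardSphereRegular_geometry (d := Fin 3) hε
  have hW := stepWindow_subset_Icc c σ N k
  have hk0 : 0 ≤ (k : ℝ) * stepLen c σ N := mul_nonneg k.cast_nonneg (stepLen_pos hc hσ N).le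
  set J := Set.ncard (collisionTimesOf G3 (hsDiameter σ N) (fun t => Φ.flow t z) i ∩
    Set.Ioc 0 (((k : ℝ) + 1) * stepLen c σ N)) with hJ
  have hmono := Φ.strictMonoOn_nthCollisionTimeOf_window hz i (((k : ℝ) + 1) * stepLen c σ N)
  -- the fiber is the injective image of the filtered index range
  have himage : (collTriples Φ (stepWindow c σ N k) z).filter (fun e => e.2.1 = i) =
      ((Finset.range J).filter (fun n => (k : ℝ) * stepLen c σ N < Φ.nthCollisionTimeOf i n z)).image
        (fun n => (Φ.nthCollisionTimeOf i n z, i, Φ.nthPartnerOf i n z)) := by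
    ext e
    simp only [Finset.mem_filter, Finset.mem_image, Finset.mem_range]
    constructor
    · rintro ⟨he, hei⟩
      obtain ⟨hew, hep⟩ := (mem_collTriples Φ hz hW).1 he
      have hp : (i, e.2.2) ∈ contactPairs G3 (hsDiameter σ N) (Φ.flow e.1 z) := by
        rw [← hei]; exact hep
      have hwin : e.1 ∈ collisionTimesOf G3 (hsDiameter σ N) (fun t => Φ.flow t z) i ∩
          Set.Ioc 0 (((k : ℝ) + 1) * stepLen c σ N) :=
        ⟨⟨e.2.2, Or.inl hp⟩, hk0.trans_lt hew.1, hew.2⟩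
      obtain ⟨n, hn, hne⟩ := Φ.exists_lt_ncard_nthCollisionTimeOf_eq hz i hwin
      have hpn : Φ.nthPartnerOf i n z = e.2.2 := Φ.nthPartnerOf_eq hz (by rw [hne]; exact hp)
      refine ⟨n, ⟨hn, by rw [hne]; exact hew.1⟩, ?_⟩
      rw [hne, hpn, ← hei]
    · rintro ⟨n, ⟨hn, hkn⟩, rfl⟩
      have hmem := Φ.nthCollisionTimeOf_mem_window hz i hn
      obtain ⟨l, hl⟩ := hmem.1
      have hil : (i, l) ∈ contactPairs G3 (hsDiameter σ N) (Φ.flow (Φ.nthCollisionTimeOf i n z) z) := by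
        rcases hl with h | h
        · exact h
        · exact (swap_mem_contactPairs_iff hG (p := (l, i))).2 h
      have hpn : Φ.nthPartnerOf i n z = l := Φ.nthPartnerOf_eq hz hil
      refine ⟨(mem_collTriples Φ hz hW).2 ⟨⟨hkn, hmem.2.2⟩, ?_⟩, rfl⟩
      show (i, Φ.nthPartnerOf i n z) ∈ _
      rw [hpn]; exact hil
  rw [himage, Finset.sum_image]
  intro x hx y hy hxy
  have hx' : x < J := Finset.mem_range.1 (Finset.mem_filter.1 hx).1
  have hy' : y < J := Finset.mem_range.1 (Finset.mem_filter.1 hy).1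
  exact hmono.injOn hx' hy' (congrArg Prod.fst hxy)

/-- **The owned count read off the observations.** On the good set (`0 < c`, `0 < σ < 1/2`):
`ownedCount k q z = (n̄c)⁻¹ Σ_{i : (obs k z i).1.1 = q} Σ_{r ∈ (obs (k+1) z i).2} (𝟙{¬ (obs k z r.1).1.1 <ₗₑₓ q} + 𝟙{q <ₗₑₓ (obs k z r.1).1.1})`
— start cells from the snapshot `obs k`, the records of the spheres starting in `q` from `obs (k+1)` (their `jumps` of step
`k`, which list the partner labels). [folklore] -/
theorem ownedCount_eq_sum_obs (hz : z ∈ Φ.good) {c : ℝ} (hc : 0 < c) (hσ : 0 < σ) (hσ2 : σ < 2⁻¹) (b : ℝ) (k : ℕ)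
    (q : Cell) :
    ownedCount c σ N Φ k q z = (cellCount c σ N * c)⁻¹ *
      ∑ i : Fin (N + 1), (if (obs b c σ N Φ k z i).1.1 = q then
        (((obs b c σ N Φ (k + 1) z i).2.map fun r =>
          (if cellLT (obs b c σ N Φ k z r.1).1.1 q then (0 : ℝ) else 1) +
            (if cellLT q (obs b c σ N Φ k z r.1).1.1 then (1 : ℝ) else 0))).sum else 0) := by
  have hobs1 : ∀ j, (obs b c σ N Φ k z j).1.1 = startCell c σ N Φ k z j := by
    intro j; simp only [obs, hz, if_true]; rfl
  have hobs2 : ∀ j, (obs b c σ N Φ (k + 1) z j).2 = jumps b c σ N Φ (k + 1) j z := by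
    intro j; simp only [obs, hz, if_true]
  simp_rw [hobs1, hobs2]
  rw [ownedCount_eq_sum Φ hz, sum_ite_cellMin_eq Φ hz hσ hσ2 c k q,
    ← Finset.sum_fiberwise (collTriples Φ (stepWindow c σ N k) z) (fun e => e.2.1)]
  congr 1
  refine Finset.sum_congr rfl fun i _ => ?_
  have hfib : ∑ e ∈ (collTriples Φ (stepWindow c σ N k) z).filter (fun e => e.2.1 = i),
      (if startCell c σ N Φ k z e.2.1 = q then
        ((if cellLT (startCell c σ N Φ k z e.2.2) q then (0 : ℝ) else 1) +
          (if cellLT q (startCell c σ N Φ k z e.2.2) then (1 : ℝ) else 0)) else 0) =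
      ∑ e ∈ (collTriples Φ (stepWindow c σ N k) z).filter (fun e => e.2.1 = i),
      (if startCell c σ N Φ k z i = q then
        ((if cellLT (startCell c σ N Φ k z e.2.2) q then (0 : ℝ) else 1) +
          (if cellLT q (startCell c σ N Φ k z e.2.2) then (1 : ℝ) else 0)) else 0) :=
    Finset.sum_congr rfl fun e he => by rw [(Finset.mem_filter.1 he).2]
  rw [hfib]
  by_cases hi : startCell c σ N Φ k z i = q
  · simp only [hi, if_true]
    rw [sum_filter_fst_eq_sum_range Φ hz hc hσ hσ2 k i (fun _ j =>
      (if cellLT (startCell c σ N Φ k z j) q then (0 : ℝ) else 1) +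
        (if cellLT q (startCell c σ N Φ k z j) then (1 : ℝ) else 0))]
    simp only [jumps, List.map_map, Function.comp_def, Nat.cast_succ, add_sub_cancel_right]
    rw [sum_map_filter_range]
  · simp only [hi, if_false, Finset.sum_const_zero]

/-- **Registered helper `ownedCount_eq_of_seqHistLE_eq` (piece H4/D, the revealed dictionary): on the good set the owned
collision count of the unit `(k, q)` is a function of the data revealed right after `(k, q)`.** For `0 < c`, `0 < σ < 1/2`,
every bin width `b`, step `k`, cell `q` and good phase points `z, z'` with `seqHistLE b c σ N Φ k q z' = seqHistLE b c σ N Φ k q z`: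
`ownedCount c σ N Φ k q z' = ownedCount c σ N Φ k q z` (the snapshot `obs k` is the last entry of the common history; a sphere
starting in `q` is not strictly above `q`, so its step-`k` observation is revealed; then `ownedCount_eq_sum_obs`). [folklore] -/
theorem ownedCount_eq_of_seqHistLE_eq : ∀ {σ : ℝ} {N : ℕ} (Φ : Flow σ N) (b c : ℝ) (k : ℕ) (q : Cell) {z z' : Phase N}, z ∈ Φ.good → z' ∈ Φ.good → 0 < c → 0 < σ → σ < 2⁻¹ → seqHistLE b c σ N Φ k q z' = seqHistLE b c σ N Φ k q z → ownedCount c σ N Φ k q z' = ownedCount c σ N Φ k q z := by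
  intro σ N Φ b c k q z z' hz hz' hc hσ hσ2 hH
  have h1 := congrFun (congrArg Prod.fst hH) (Fin.last k)
  have h2 := congrArg Prod.snd hH
  have hk : obs b c σ N Φ k z' = obs b c σ N Φ k z := by
    simp only [seqHistLE, hist, Fin.val_last] at h1
    exact h1
  have hk1 : ∀ i, (obs b c σ N Φ k z i).1.1 = q → obs b c σ N Φ (k + 1) z' i = obs b c σ N Φ (k + 1) z i := by
    intro i hi
    have h3 := congrFun h2 i
    simp only [seqHistLE] at h3
    rw [hk, hi, if_neg (cellLT_irrefl q), if_neg (cellLT_irrefl q)] at h3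
    exact Option.some_injective _ h3
  rw [ownedCount_eq_sum_obs Φ hz' hc hσ hσ2 b k q, ownedCount_eq_sum_obs Φ hz hc hσ hσ2 b k q, hk]
  congr 1
  refine Finset.sum_congr rfl fun i _ => ?_
  by_cases hi : (obs b c σ N Φ k z i).1.1 = q
  · rw [if_pos hi, if_pos hi, hk1 i hi]
  · rw [if_neg hi, if_neg hi]

end Dictionary

end Summit.AtomisticToContinuum.HydrodynamicLimit.Theorems.EquilibriumForecastLine

end
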